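import Literature.MathematicalPhysics.QuantumChemistry.GarrodPercusEigenvalueBoundReal
import Literature.MathematicalPhysics.QuantumChemistry.T1OperatorBound
import Literature.MathematicalPhysics.QuantumChemistry.T2PrimeOperatorBound
import HarnessLib

/-!
# The three-index operator constants in the REAL SYMMETRIC programme (`x̄ · 1 − X ⪰ 0` over `ℝ`)

Topic `Literature/MathematicalPhysics/QuantumChemistry`; companion of `GarrodPercusEigenvalueBoundReal.lean`
(the transport lemma `posSemidef_smul_one_sub_map_re`: `c · 1 − A ⪰ 0` over `ℂ` with real `c` gives
`c · 1 − Re A ⪰ 0` over `ℝ`, and the real-programme constants for `Γ`, `G`, `Q`) and of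
`T1OperatorBound.lean`, `T2OperatorBound.lean`, `T2PrimeOperatorBound.lean` (the complex Löwner bounds
`(9N + 6) · 1 − T1 ⪰ 0`, `N(r + 2) · 1 − T2 ⪰ 0`, `(N(r + 2) + 1) · 1 − T2′ ⪰ 0` on the three-index rungs).
HONEST FRAMING (cell chem-oracle, LADDER-CHEM I-TYPE slot 08): statements about a finite model
Hamiltonian's reduced density matrices and their semidefinite relaxations; this file certifies no number.

WHY THIS FILE. The a-posteriori theorems that consume the a-priori constants are typed over REAL
matrices (`JanssonChaykinKeil.theorem_3_2`: `hub : (x̄_j • 1 − X_j).PosSemidef`;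
`Jansson2007.corollary_6_1a_feasible`: `hXub`), because the rigorous-bound theory is stated for real
symmetric block SDPs: Chaykin, Jansson, Keil, Lange, Ohlhus, Rump (2016) §5 Theorem 2 (5.19) "Assume
further that upper bounds for the maximal eigenvalues of the primal feasible solution … `λmax(X_j) ≤ x_j`
are known", for the primal block variable `X = diag(γ, I−γ, Γ, Q, G, T1, T2)` of §4.1 with the trace
constants (4.6) `λmax(T1) ≤ (r−2)(r(r−1) − 3N(r−N)), λmax(T2) ≤ Nr(r−N), λmax(T2′) ≤ N(r(r−N)+1)` — the
list of Chaykin's thesis (2009) (3.67). [cite: Chaykin2009Thesis, §3.4.3 eq. (3.67), p. 40]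
The primal blocks of the real programme are the ENTRYWISE REAL PARTS of a feasible pair's matrices; this
file transports the complex three-index bounds to exactly that shape, with the tree's SHARPER constants.

WHAT IS PROVED (0 sorry, no definition, no named fact; each a one-line transport):
* `IsDQGT1Feasible.posSemidef_smul_one_sub_t1Map_re` — `(9N + 6 : ℝ) • 1 − (t1Map γ Γ).map re ⪰ 0`
  (and on the `PQGT1T2` / `PQGT1T2′` rungs);
* `IsDQGT1T2Feasible.posSemidef_smul_one_sub_t2Map_re` — `(N(r+2) : ℝ) • 1 − (t2Map γ Γ).map re ⪰ 0`
  (and on the `PQGT1T2′` rung);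
* `IsDQGT1T2PrimeFeasible.posSemidef_smul_one_sub_t2PrimeMap_re` —
  `(N(r+2) + 1 : ℝ) • 1 − (t2PrimeMap γ Γ).map re ⪰ 0`.
-/

noncomputable section

namespace Literature.MathematicalPhysics.QuantumChemistry

open Matrix Finset Literature.MathematicalPhysics.QuantumLattice
open scoped ComplexOrder

section ThreeIndexReal

variable {ι : Type*} [LinearOrder ι] [Fintype ι]
variable {N : ℕ} {γ : Matrix ι ι ℂ} {Γ : Matrix (ι × ι) (ι × ι) ℂ}

/-- **`x̄_{T1} = 9N + 6` in the real programme** (`PQGT1` rung):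
`(9N + 6) · 1 − Re T1 ⪰ 0` over `ℝ`, the shape of `hub` / `hXub` — transport of
`IsDQGT1Feasible.posSemidef_smul_one_sub_t1Map`; replaces the printed `(r−2)(r(r−1) − 3N(r−N))` of
Chaykin (2009) (3.67) / Chaykin et al. (2016) (4.6). [cite: Chaykin2009Thesis, §3.4.3 eq. (3.67), p. 40] -/
theorem IsDQGT1Feasible.posSemidef_smul_one_sub_t1Map_re (h : IsDQGT1Feasible N γ Γ) :
    (((9 * N + 6 : ℕ) : ℝ) • (1 : Matrix (ι × ι × ι) (ι × ι × ι) ℝ) -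
      (t1Map γ Γ).map Complex.re).PosSemidef := by
  have h1 := h.posSemidef_smul_one_sub_t1Map
  rw [← Complex.ofReal_natCast] at h1
  exact posSemidef_smul_one_sub_map_re h1

/-- The same on the `PQGT1T2` rung. [cite: Chaykin2009Thesis, §3.4.3 eq. (3.67), p. 40] -/
theorem IsDQGT1T2Feasible.posSemidef_smul_one_sub_t1Map_re (h : IsDQGT1T2Feasible N γ Γ) :
    (((9 * N + 6 : ℕ) : ℝ) • (1 : Matrix (ι × ι × ι) (ι × ι × ι) ℝ) -
      (t1Map γ Γ).map Complex.re).PosSemidef :=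
  h.isDQGT1Feasible.posSemidef_smul_one_sub_t1Map_re

/-- The same on the `PQGT1T2′` rung. [cite: Chaykin2009Thesis, §3.4.3 eq. (3.67), p. 40] -/
theorem IsDQGT1T2PrimeFeasible.posSemidef_smul_one_sub_t1Map_re (h : IsDQGT1T2PrimeFeasible N γ Γ) :
    (((9 * N + 6 : ℕ) : ℝ) • (1 : Matrix (ι × ι × ι) (ι × ι × ι) ℝ) -
      (t1Map γ Γ).map Complex.re).PosSemidef :=
  h.isDQGT1Feasible.posSemidef_smul_one_sub_t1Map_re

/-- **`x̄_{T2} = N(r + 2)` in the real programme** (`PQGT1T2` rung, `r = |ι|`):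
`N(r+2) · 1 − Re T2 ⪰ 0` over `ℝ` — transport of `IsDQGT1T2Feasible.posSemidef_smul_one_sub_t2Map`;
replaces the printed `rN(r−N)` of Chaykin (2009) (3.67) / Chaykin et al. (2016) (4.6).
[cite: Chaykin2009Thesis, §3.4.3 eq. (3.67), p. 40] -/
theorem IsDQGT1T2Feasible.posSemidef_smul_one_sub_t2Map_re (h : IsDQGT1T2Feasible N γ Γ) :
    (((N : ℝ) * (Fintype.card ι + 2)) • (1 : Matrix (ι × ι × ι) (ι × ι × ι) ℝ) -
      (t2Map γ Γ).map Complex.re).PosSemidef := by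
  have h1 := h.posSemidef_smul_one_sub_t2Map
  have hc : (N : ℂ) * (Fintype.card ι + 2) = ((((N : ℝ) * (Fintype.card ι + 2) : ℝ)) : ℂ) := by
    push_cast; ring
  rw [hc] at h1
  exact posSemidef_smul_one_sub_map_re h1

/-- The same on the `PQGT1T2′` rung. [cite: Chaykin2009Thesis, §3.4.3 eq. (3.67), p. 40] -/
theorem IsDQGT1T2PrimeFeasible.posSemidef_smul_one_sub_t2Map_re (h : IsDQGT1T2PrimeFeasible N γ Γ) :
    (((N : ℝ) * (Fintype.card ι + 2)) • (1 : Matrix (ι × ι × ι) (ι × ι × ι) ℝ) -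
      (t2Map γ Γ).map Complex.re).PosSemidef :=
  h.toIsDQGT1T2Feasible.posSemidef_smul_one_sub_t2Map_re

/-- **`x̄_{T2′} = N(r + 2) + 1` in the real programme** (`PQGT1T2′` rung):
`(N(r+2) + 1) · 1 − Re T2′ ⪰ 0` over `ℝ` — transport of
`IsDQGT1T2PrimeFeasible.posSemidef_smul_one_sub_t2PrimeMap`; replaces the printed `N(r(r−N)+1)` of
Chaykin et al. (2016) (4.6). [cite: Chaykin2009Thesis, §3.4.3 eq. (3.67), p. 40] -/
theorem IsDQGT1T2PrimeFeasible.posSemidef_smul_one_sub_t2PrimeMap_re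
    (h : IsDQGT1T2PrimeFeasible N γ Γ) :
    (((N : ℝ) * (Fintype.card ι + 2) + 1) •
        (1 : Matrix ((ι × ι × ι) ⊕ ι) ((ι × ι × ι) ⊕ ι) ℝ) -
      (t2PrimeMap γ Γ).map Complex.re).PosSemidef := by
  have h1 := h.posSemidef_smul_one_sub_t2PrimeMap
  have hc : (N : ℂ) * (Fintype.card ι + 2) + 1 =
      ((((N : ℝ) * (Fintype.card ι + 2) + 1 : ℝ)) : ℂ) := by
    push_cast; ring
  rw [hc] at h1
  exact posSemidef_smul_one_sub_map_re h1

end ThreeIndexReal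

end Literature.MathematicalPhysics.QuantumChemistry

end
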